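import Summits.Langlands.Langlands.Theses.ParityBlindBianchi
import Summits.Langlands.Langlands.Theorems.IcosahedralDescentLevel.Negative.AllParityOfDoorOfDescent
import Literature.FieldTheory.AlgClosed.PadicAlgClEquivComplex

/-!
# Route ParityBlindBianchi — `EvenArtinJunction` (stmt-Langlands-2908): logical position

`EvenArtinJunction := ⟨body of EvenIcosahedralStrongArtin, verbatim⟩ → Langlands` is the JUNCTION of
the three (now four) even-Artin routes: the complement, inside the summit `Langlands` (reciprocity for
`GL_n` over every number field, both directions, local–global compatibility at every finite place), of
the sector `EvenIcosahedralStrongArtin` (strong Artin in Tunnell's a.e. sense for the irreducible even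
icosahedral `ρ : Γ_ℚ → GL₂(ℂ)` — the route TARGET, stmt-Langlands-2903). It is the fifth hypothesis of
the deciding theorem
`Theses.ParityBlindBianchi.closes : ResidualBianchiDoorLevel → TwoAdicBianchiProModularityLevel →
ArtinWeightRealisationLevel → IcosahedralDescentLevel → EvenArtinJunction → Langlands`, filed only so
that `closes` ends in the summit constant by name ("not this route's business"; shared verbatim with
routes EvenArtinGL4Door, EvenIcosahedralCMCorner, SexticResolventInduction).

This file does NOT assert the item (nor its negation), and deliberately contains no theorem whose
conclusion is the item or `¬ Langlands` under hypotheses (so that no audit credits a conditional arrow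
such as `Langlands → EvenArtinJunction` as progress on the item). It records, kernel-checked and in
`↔` form, exactly where the item sits, so that its status `open-problem` is a theorem-shaped fact
rather than a remark (same bookkeeping as `Theorems/PhantomRMYoshidaPhantomRMJunction.lean` and
`Theorems/SkinnerWilesDefectOneSectorComplement.lean` for the sibling junction / sector-complement
items stmt-Langlands-13643 and stmt-Langlands-12923):

* `parityBlindBianchi_evenArtinJunction_iff_imp`: the junction is literally the arrow
  `EvenIcosahedralStrongArtin → Langlands` (`Iff.rfl`: the hypothesis is the target's body verbatim);
* `parityBlindBianchi_evenArtinJunction_iff_not_or`: truth table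
  `EvenArtinJunction ↔ ¬ EvenIcosahedralStrongArtin ∨ Langlands` — the item is PROVABLE only by
  proving the summit or by refuting the route target (a counterexample to `GL₂` reciprocity in the
  even icosahedral Artin sector over `ℚ`);
* `parityBlindBianchi_evenArtinJunction_iff_of_target`: under the route target,
  `EvenArtinJunction ↔ Langlands`;
* `parityBlindBianchi_evenArtinJunction_iff_of_cruxes`: under the four other hypotheses of `closes`
  (E1′, E2′, R′, D′), `EvenArtinJunction ↔ Langlands` — once the route's own cruxes land, this item IS
  the summit;
* `parityBlindBianchi_not_evenArtinJunction_iff`: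
  `¬ EvenArtinJunction ↔ EvenIcosahedralStrongArtin ∧ ¬ Langlands` — a refutation must PROVE the
  (open) even icosahedral strong Artin conjecture AND disprove the formal summit;
* `parityBlindBianchi_evenArtinJunction_localLanglandsDebt`: junction + target give a local
  Langlands datum for the general linear groups over `F_v` at every finite place `v` of every number
  field `F` (the `llc` field of the reciprocity data `𝓡` the summit asserts to exist) — Harris–Taylor /
  Henniart content, the named fact `LocalLanglandsDatum.nonempty`, far outside the `GL₂/ℚ` Artin
  sector;
* `parityBlindBianchi_evenArtinJunction_globalDebt`: junction + target give BOTH directions of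
  reciprocity for every `GL_n`, `n ≥ 1`, over every number field, with local–global compatibility at
  every finite place — of which the sector's conclusion (a.e. Satake matching on `GL₂/ℚ` for the even
  icosahedral Artin `ρ`) is a shadow of the `n = 2`, `F = ℚ` instance of (B).
-/

set_option linter.dupNamespace false -- project-wide option; `Summit.Langlands.Langlands` is the mandated namespace

namespace Summit.Langlands.Langlands.Theorems

open Summit.Langlands.Langlands.Theses.ParityBlindBianchi

/-- The junction is definitionally the arrow `EvenIcosahedralStrongArtin → Langlands`: its hypothesis
is the body of the route target, verbatim. [folklore] -/
theorem parityBlindBianchi_evenArtinJunction_iff_imp :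
    EvenArtinJunction ↔ (EvenIcosahedralStrongArtin → _root_.Langlands) :=
  Iff.rfl

/-- Truth table of the junction: `EvenArtinJunction ↔ ¬ EvenIcosahedralStrongArtin ∨ Langlands`. In
particular `Langlands → EvenArtinJunction` (discard the sector) and
`¬ EvenIcosahedralStrongArtin → EvenArtinJunction` (ex falso) are its two cheap directions, and there
is no third: the item is provable only by proving the summit or by refuting the route target.
[folklore] -/
theorem parityBlindBianchi_evenArtinJunction_iff_not_or :
    EvenArtinJunction ↔ ¬ EvenIcosahedralStrongArtin ∨ _root_.Langlands :=
  imp_iff_not_or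

/-- Under the route TARGET `EvenIcosahedralStrongArtin`, the junction is literally the summit:
`EvenArtinJunction ↔ Langlands`. [folklore] -/
theorem parityBlindBianchi_evenArtinJunction_iff_of_target (hX : EvenIcosahedralStrongArtin) :
    EvenArtinJunction ↔ _root_.Langlands :=
  ⟨fun hJ ↦ hJ hX, fun h _ ↦ h⟩

/-- Under the other four hypotheses of the deciding theorem — E1′ `ResidualBianchiDoorLevel`, E2′
`TwoAdicBianchiProModularityLevel`, R′ `ArtinWeightRealisationLevel`, D′ `IcosahedralDescentLevel` —
the junction is equivalent to the summit: `EvenArtinJunction ↔ Langlands` (`→` is the route's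
sorry-free `closes`). So this item can close only together with the summit once the route's cruxes
land. [folklore] -/
theorem parityBlindBianchi_evenArtinJunction_iff_of_cruxes (hE1 : ResidualBianchiDoorLevel)
    (hE2 : TwoAdicBianchiProModularityLevel) (hR : ArtinWeightRealisationLevel)
    (hD : IcosahedralDescentLevel) : EvenArtinJunction ↔ _root_.Langlands :=
  -- buildfix 2026-08-20 (proof-only; statement unchanged): since route rev 17/18 the deciding
  -- theorem `closes` consumes the BC-conditional / even-sector cruxes, so the rev-≤16 term
  -- `closes hE1 hE2 hR hD hJ` no longer typechecks.  The `→` direction now goes through the landed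
  -- negative-side lemma `IcosahedralDescentLevel.Negative.allParity_of_door_of_descent`
  -- (E1′ and D′ as typed already give a.e. strong Artin for EVERY irreducible icosahedral `ρ/ℚ`,
  -- in particular the even ones = the route target), with `ι : ℚ̄₂ ≃+* ℂ` from Steinitz
  -- (`PadicAlgCl.nonempty_ringEquiv_complex`); E2′ and R′ are carried but not needed.
  ⟨fun hJ ↦ by
      have _hE2 := hE2
      have _hR := hR
      obtain ⟨ι⟩ := PadicAlgCl.nonempty_ringEquiv_complex 2
      exact hJ fun ρ hirr hA5 _ ↦
        IcosahedralDescentLevel.Negative.allParity_of_door_of_descent hE1 hD ι ρ hirr hA5,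
    fun h _ ↦ h⟩

/-- The exact content of a refutation of the junction:
`¬ EvenArtinJunction ↔ EvenIcosahedralStrongArtin ∧ ¬ Langlands` — prove the open even icosahedral
strong Artin conjecture over `ℚ` AND disprove the formal summit; in particular any refutation of the
item is a disproof of `_root_.Langlands`. [folklore] -/
theorem parityBlindBianchi_not_evenArtinJunction_iff :
    ¬ EvenArtinJunction ↔ EvenIcosahedralStrongArtin ∧ ¬ _root_.Langlands :=
  Classical.not_imp

/-- The junction carries the summit's Statement debt at the local level: together with the route
target it yields, for EVERY number field `F` and EVERY finite place `v`, a local Langlands datum for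
the general linear groups over `F_v` (the `llc` field of the reciprocity data `𝓡` that `Langlands`
asserts to exist) — Harris–Taylor/Henniart content (named fact `LocalLanglandsDatum.nonempty`), far
outside the `GL₂/ℚ` Artin sector. [folklore] -/
theorem parityBlindBianchi_evenArtinJunction_localLanglandsDebt (hJ : EvenArtinJunction)
    (hX : EvenIcosahedralStrongArtin) (F : Type) [Field F] [NumberField F]
    (v : IsDedekindDomain.HeightOneSpectrum (NumberField.RingOfIntegers F)) :
    Nonempty (Literature.NumberTheory.Automorphic.LocalLanglandsDatum (v.adicCompletion F)) := by
  -- buildfix 2026-08-20 (proof-only): `Langlands F` is now `Nonempty (ReciprocityData F) ∧ ∀ 𝓡 …`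
  obtain ⟨⟨𝓡⟩, -⟩ := hJ hX F
  exact ⟨𝓡.llc v⟩

/-- The junction carries the summit's global content: together with the route target it yields, for
every number field `F`, reciprocity data `𝓡` with BOTH directions (A) `AutomorphicToGalois n` and
(B) `GaloisToAutomorphic n` for every `n ≥ 1` and every level-compactness witness, with local–global
compatibility at every finite place (`Corresponds`) — the sector's own conclusion (a.e. Satake
matching for the even icosahedral Artin `ρ` on `GL₂/ℚ`) is a shadow of the `n = 2`, `F = ℚ` instance
of (B). [folklore] -/
theorem parityBlindBianchi_evenArtinJunction_globalDebt (hJ : EvenArtinJunction)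
    (hX : EvenIcosahedralStrongArtin) (F : Type) [Field F] [NumberField F] :
    ∃ 𝓡 : Summit.Langlands.ReciprocityData F, ∀ n : ℕ, 0 < n →
      ∀ hcpt : Literature.NumberTheory.Automorphic.isCompact_glFiniteIntegralLevel n F,
        Summit.Langlands.AutomorphicToGalois n 𝓡 hcpt ∧
          Summit.Langlands.GaloisToAutomorphic n 𝓡 hcpt := by
  -- buildfix 2026-08-20 (proof-only): the re-typed summit gives reciprocity data (non-vacuity
  -- conjunct) AND `GlobalLanglandsCorrespondenceGLn n F 𝓡 hcpt := (A) ∧ (B)` for EVERY `𝓡`.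
  obtain ⟨⟨𝓡⟩, h⟩ := hJ hX F
  exact ⟨𝓡, fun n hn hcpt ↦ h 𝓡 n hn hcpt⟩

end Summit.Langlands.Langlands.Theorems
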